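import Summits.BirchSwinnertonDyer.Rank1Residual.GaloisImage.AbelianExtensionTorsion
import Literature.NumberTheory.EllipticCurves.HeegnerPointsKolyvaginPrimaryNoTorsionProofs
import Literature.NumberTheory.EllipticCurves.SelmerPInftyRelModelAction
import Mathlib.FieldTheory.Galois.Abelian
import Mathlib.NumberTheory.Cyclotomic.Basic
import HarnessLib

/-!
# BSD rank-≤1 residual cell: `E(L)[p^∞] = 0` for an ABELIAN number field `L/ℚ`
# (`p` odd, `E[p]` irreducible) — the field-of-definition form of T-R18a

HONEST FRAMING (cell `b2b-bsdres-*`, run/shared/lean/b2b/bsd-rank1-residual/, verbatim): the goal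
of the cell is to DELETE the COMBINATION-SHAPED residual classes for ALL analytic-rank `≤ 1` elliptic
curves over `ℚ` — "full BSD formula for every rank `≤ 1` curve in class C" assembled STRICTLY from
published theorems — so that the rank-`≤ 1` remainder becomes exactly the CONSTRUCTION-SHAPED
classes, which are TYPED (missing-input Props), NOT attempted; this is not "finishing BSD".
Prove what is provable now; shrink each hard class to its core with data; no claim beyond stated
classes.  Research routes; census output = EVIDENCE, never a Literature fact.  Unit
`b2b-bsdres-n1011-p11` (team n1011, ROUTE-1 sub-target R1-8 (i), OWNERS row **T-R18a**, second
file).  THEOREMS ONLY (no definition, no named fact, no instance); a TOOL file — no closure value,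
no class theorem, no label moves.

## What this file does

`AbelianExtensionTorsion.lean` proves the kernel lemma of ROUTE-1 §15.1 (i) inside `\bar ℚ`: for
`p` odd and `E[p]` irreducible, a geometric point fixed by a subgroup `U ≤ Γ_ℚ` containing the
commutator subgroup has no `p`-power torsion.  This file supplies the two dictionary entries that
turn "`U ⊇ [Γ_ℚ, Γ_ℚ]`" into "defined over an abelian extension" in the tree's two vocabularies
for fields of definition, using Mathlib's class `IsAbelianGalois` (Galois with commutative group):

* `commutator_le_fixingSubgroup_of_isAbelianGalois` — for ANY field `K` and an intermediate field
  `F ⊆ \bar K` abelian over `K`: `[Γ_K, Γ_K] ≤ Gal(\bar K/F)` (the subgroup of `Γ_K` fixing `F`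
  pointwise; restriction `Γ_K → Gal(F/K)` kills commutators).  With `K = ℚ` this feeds the `U`-form
  lemmas of `AbelianExtensionTorsion.lean` (`U = fixingSubgroup Γ_ℚ F`).  (Stated over a general
  `K`: over `ℚ` the two `Algebra ℚ ↥F` instance paths — `IntermediateField.algebra'` vs
  `DivisionRing.toRatAlgebra` — agree only up to non-reducible defeq, so consumers inside `\bar ℚ`
  should prefer the `U`-form or the `rootsOfUnityFixer` form.)
* `commutator_le_galRange_of_isAbelianGalois` — for an ABSTRACT number field `L` (in `Type`)
  abelian over `ℚ` (`IsAbelianGalois ℚ L`), `[Γ_ℚ, Γ_ℚ] ≤ galRange L`, the image of `Γ_L → Γ_ℚ`: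
  the transported lifts `liftToAbsGal L σ₀` are coset representatives of the normal subgroup
  `galRange L` (tree, `RelModel.exists_liftToAbsGal_inv_mul_mem_galRange`, `RelModel.normal_galRange`)
  acting on the copy `j(L) ⊆ \bar ℚ` as `σ₀` (`liftToAbsGal_embIntoClosure`,
  `smul_embIntoClosure_of_mem_galRange`), so `g ↦ σ_g` is multiplicative and `Γ_ℚ / galRange L` is
  commutative because `Gal(L/ℚ)` is.
* `torsionBy_eq_bot_of_isAbelianGalois_type`, `torsionBy_eq_bot_of_isAbelianGalois`,
  `torsionBy_pow_eq_bot_of_isAbelianGalois` — **`E(L)[p] = 0` and `E(L)[p^M] = 0` for every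
  abelian number field `L/ℚ`** (any universe), `p` odd, `E[p]` irreducible: a point of `E(L)[p]`
  gives a point of `E[p] = E(\bar ℚ)[p]` fixed by `galRange L ⊇ [Γ_ℚ, Γ_ℚ]` (the transport of the
  tree's Gross-Lemma-4.3 file `HeegnerPointsKolyvaginPrimaryNoTorsionProofs`, verbatim), which is
  `O` by `geomTorsion_eq_zero_of_fixed_of_commutator_le`.
* `torsionBy_pow_eq_bot_of_isCyclotomicExtension` — the case `L = ℚ(ζ_N)` (Mathlib:
  cyclotomic extensions are `IsAbelianGalois`), the field carrying the cusps of `X₀(N)` in F-d v2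
  (ii) (Stevens 1982, Thm 1.3.1 (a)); and `…_of_classX4` row reading.

Nothing here is specific to a reduction type; nothing at `p = 2`; no statement about cusps or
periods (T-R18b).

## References

* [Serre1972] J.-P. Serre, Invent. Math. 15 (1972) 259–331, §5.2 (iv), §5.4 (the mechanism of
  the kernel lemma).
* [GrossLMS1991] B. H. Gross, *Kolyvagin's work on modular elliptic curves*, LMS LN 153 (1991),
  Lemma 4.3 (the transport `E(L)[p] ↪ E[p]^{Γ_L}` reused here is the tree's formalisation of its
  proof).
* Cell files: `cells/n1011/ROUTE-1.md` §15.1 (i)–(ii), §15.4 R1-8; `cells/n1011/skel/T-R18a.md`.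
-/

noncomputable section

open scoped Classical commutatorElement
open Field
open WeierstrassCurve Literature.NumberTheory.EllipticCurves Literature.NumberTheory.GaloisRepresentations
  Literature.NumberTheory.EllipticCurves.Rank1Residual

universe u

namespace Summit.BirchSwinnertonDyer.Rank1Residual.GaloisImage

/-! ### Abelian subfields of `\bar K`: `[Γ_K, Γ_K] ≤ Gal(\bar K/F)` -/

/-- **For `F ⊆ \bar K` abelian over `K`, the commutator subgroup of `Γ_K` fixes `F` pointwise**:
`[Γ_K, Γ_K] ≤ Gal(\bar K/F)`, the subgroup of `Γ_K = Gal(\bar K/K)` fixing `(F : Set \bar K)`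
(Mathlib `fixingSubgroup` for the action of `Γ_K` on `\bar K`).  Restriction `Γ_K → Gal(F/K)`
(`AlgEquiv.restrictNormalHom`) sends a commutator to a commutator of the commutative group
`Gal(F/K)`, i.e. to `1` (`AlgEquiv.restrictNormal_eq_one_iff`).  Any base field `K`. [folklore] -/
theorem commutator_le_fixingSubgroup_of_isAbelianGalois {K : Type u} [Field K]
    (F : IntermediateField K (AlgebraicClosure K)) [IsAbelianGalois K F] :
    commutator (absoluteGaloisGroup K) ≤
      fixingSubgroup (absoluteGaloisGroup K) (F : Set (AlgebraicClosure K)) := by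
  rw [commutator_eq_closure, Subgroup.closure_le]
  rintro x ⟨g, h, rfl⟩
  rw [SetLike.mem_coe, mem_fixingSubgroup_iff]
  intro y hy
  have h1 : AlgEquiv.restrictNormalHom F (absoluteGaloisGroup.toAlgEquiv K ⁅g, h⁆) = 1 := by
    rw [map_commutatorElement, map_commutatorElement, commutatorElement_eq_one_iff_mul_comm]
    exact IsMulCommutative.is_comm.comm _ _
  rw [absoluteGaloisGroup.smul_def]
  exact (AlgEquiv.restrictNormal_eq_one_iff F _).mp h1 y hy

/-! ### Abstract abelian number fields `L`: `[Γ_ℚ, Γ_ℚ] ≤ galRange L` -/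

/-- **For an abelian number field `L/ℚ`, the image `galRange L` of `Γ_L → Γ_ℚ` contains the
commutator subgroup of `Γ_ℚ`.**  Proof: `N = galRange L` is normal with the transported lifts
`c_σ = liftToAbsGal L σ`, `σ ∈ Gal(L/ℚ)`, as coset representatives (`RelModel.normal_galRange`,
`RelModel.exists_liftToAbsGal_inv_mul_mem_galRange`); on the copy `j(L) ⊆ \bar ℚ`
(`j = embIntoClosure L`) an element `g ∈ c_σ N` acts as `σ` (`liftToAbsGal_embIntoClosure`,
`smul_embIntoClosure_of_mem_galRange`), so `g ↦ σ_g` is multiplicative (`j` injective) and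
`ḡ h̄ = c̄_{σ_g σ_h} = c̄_{σ_h σ_g} = h̄ ḡ` in `Γ_ℚ/N` since `Gal(L/ℚ)` is commutative; hence every
commutator lies in `N`. [folklore] -/
theorem commutator_le_galRange_of_isAbelianGalois (L : Type) [Field L] [NumberField L]
    [IsAbelianGalois ℚ L] :
    commutator (absoluteGaloisGroup ℚ) ≤ galRange (K := ℚ) L := by
  haveI := RelModel.normal_galRange (K := ℚ) L
  set N := galRange (K := ℚ) L with hN
  set j : L →ₐ[ℚ] AlgebraicClosure ℚ := embIntoClosure (K := ℚ) L with hj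
  set c : (L ≃ₐ[ℚ] L) → absoluteGaloisGroup ℚ := liftToAbsGal (K := ℚ) L with hc
  -- every `g ∈ Γ_ℚ` lies in the coset of a transported lift `c σ` and acts on `j(L)` as `σ`
  have hact : ∀ g : absoluteGaloisGroup ℚ, ∃ σ : L ≃ₐ[ℚ] L,
      (g : absoluteGaloisGroup ℚ ⧸ N) = (c σ : absoluteGaloisGroup ℚ ⧸ N) ∧
        ∀ x : L, g • j x = j (σ x) := by
    intro g
    obtain ⟨σ, hσ⟩ := RelModel.exists_liftToAbsGal_inv_mul_mem_galRange (K := ℚ) L g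
    refine ⟨σ, ?_, fun x ↦ ?_⟩
    · rw [eq_comm, QuotientGroup.eq]
      exact hσ
    · have h1 : ((c σ)⁻¹ * g) • j x = j x := smul_embIntoClosure_of_mem_galRange L hσ x
      have h2 : c σ • j x = j (σ x) := liftToAbsGal_embIntoClosure L σ x
      calc g • j x = c σ • (((c σ)⁻¹ * g) • j x) := by rw [mul_smul, smul_inv_smul]
        _ = j (σ x) := by rw [h1, h2]
  choose σ hσmk hσact using hact
  -- `g ↦ σ_g` is multiplicative, so the cosets commute
  have hmul : ∀ g h : absoluteGaloisGroup ℚ, σ (g * h) = σ g * σ h := fun g h ↦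
    AlgEquiv.ext fun x ↦ j.injective (by
      change j (σ (g * h) x) = j ((σ g * σ h) x)
      rw [← hσact, mul_smul, hσact h, hσact g, AlgEquiv.mul_apply])
  have hcommk : ∀ g h : absoluteGaloisGroup ℚ,
      (g : absoluteGaloisGroup ℚ ⧸ N) * h = h * g := by
    intro g h
    rw [← QuotientGroup.mk_mul, ← QuotientGroup.mk_mul, hσmk (g * h), hσmk (h * g), hmul, hmul,
      IsMulCommutative.is_comm.comm (σ h) (σ g)]
  rw [commutator_eq_closure, Subgroup.closure_le]
  rintro x ⟨g, h, rfl⟩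
  rw [SetLike.mem_coe, ← QuotientGroup.eq_one_iff, ← QuotientGroup.mk'_apply, map_commutatorElement,
    commutatorElement_eq_one_iff_mul_comm, QuotientGroup.mk'_apply, QuotientGroup.mk'_apply]
  exact hcommk g h

variable (W : WeierstrassCurve ℚ) [W.IsElliptic] (p : ℕ) [hp : Fact p.Prime]

/-! ### `E(L)[p^∞] = 0` for an abelian number field `L` -/

/-- **`E(L)[p] = 0` for an abelian number field `L/ℚ`** (`L` in `Type`), `p` odd, `E[p]`
irreducible.  Proof: a point `0 ≠ P ∈ E(L)[p]` gives, through `E(L) ↪ E(\bar L) ≅ E(\bar ℚ)`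
(`pointsMap`, `pointsMapOfEmb_bijective`), a point `0 ≠ Q ∈ E[p]` fixed by the image `galRange L`
of `Γ_L` (`pointsMap_smul`) — the transport of the tree's Gross 1991 Lemma 4.3 file, verbatim —
and `galRange L ⊇ [Γ_ℚ, Γ_ℚ]` (`commutator_le_galRange_of_isAbelianGalois`), so `Q = O` by the
kernel lemma `geomTorsion_eq_zero_of_fixed_of_commutator_le`. [cite: Serre1972, §5.2 (iv) and §5.4] -/
theorem torsionBy_eq_bot_of_isAbelianGalois_type (L : Type) [Field L] [NumberField L]
    [IsAbelianGalois ℚ L] (hp2 : p ≠ 2) (hirr : W.HasIrreducibleModPGaloisRep p) :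
    AddSubgroup.torsionBy (W.baseChange L).toAffine.Point (p : ℤ) = ⊥ := by
  rw [eq_bot_iff]
  intro P hP
  rw [AddSubgroup.mem_bot]
  by_contra hP0
  have hPp : p • P = 0 := AddSubgroup.torsionBy.nsmul_iff.mp hP
  -- the point over `\bar L` and its preimage `Q` over `\bar ℚ`
  let f : L →ₐ[ℚ] AlgebraicClosure L := (algebraMap L (AlgebraicClosure L)).toRatAlgHom
  let φ : (W.baseChange L).toAffine.Point →+ localPoints W L :=
    WeierstrassCurve.Affine.Point.map f
  have hφ : Function.Injective φ := WeierstrassCurve.Affine.Point.map_injective _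
  obtain ⟨Q, hQ⟩ := (pointsMapOfEmb_bijective L W (closureEmb (K := ℚ) L)).2 (φ P)
  have hQ' : pointsMap W L Q = φ P := hQ
  have hinj : Function.Injective (pointsMap W L) :=
    (pointsMapOfEmb_bijective L W (closureEmb (K := ℚ) L)).1
  have hQ0 : Q ≠ 0 := by
    rintro rfl
    apply hP0
    apply hφ
    rw [map_zero, ← hQ', map_zero]
  have hQp : p • Q = 0 := by
    apply hinj
    rw [map_nsmul, map_zero, hQ', ← map_nsmul, hPp, map_zero]
  -- `Q` is fixed by `Γ_L`, i.e. by `galRange L`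
  have hfixL : ∀ τ : absoluteGaloisGroup L, resGal (K := ℚ) L τ • Q = Q := by
    intro τ
    apply hinj
    rw [pointsMap_smul, hQ']
    change WeierstrassCurve.Affine.Point.map
        ((AlgEquiv.restrictScalars ℚ (absoluteGaloisGroup.toAlgEquiv L τ) :
            AlgebraicClosure L ≃ₐ[ℚ] AlgebraicClosure L) :
          AlgebraicClosure L →ₐ[ℚ] AlgebraicClosure L)
        (WeierstrassCurve.Affine.Point.map f P) =
      WeierstrassCurve.Affine.Point.map f P
    have hgf : ((AlgEquiv.restrictScalars ℚ (absoluteGaloisGroup.toAlgEquiv L τ) :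
            AlgebraicClosure L ≃ₐ[ℚ] AlgebraicClosure L) :
          AlgebraicClosure L →ₐ[ℚ] AlgebraicClosure L).comp f = f := by
      ext x
      exact (absoluteGaloisGroup.toAlgEquiv L τ).commutes x
    rw [WeierstrassCurve.Affine.Point.map_map, hgf]
  have hfix : ∀ n ∈ galRange (K := ℚ) L, n • Q = Q := fun n hn ↦ by
    obtain ⟨τ, rfl⟩ := (mem_galRange_iff L n).mp hn
    exact hfixL τ
  -- the kernel lemma in `E[p]`
  let Qm : geomTorsion W p := ⟨Q, AddSubgroup.torsionBy.nsmul_iff.mpr hQp⟩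
  have hQm : ∀ n ∈ galRange (K := ℚ) L, n • Qm = Qm := fun n hn ↦ Subtype.ext (hfix n hn)
  have hQm0 : Qm = 0 := geomTorsion_eq_zero_of_fixed_of_commutator_le W p hp2 hirr
    (commutator_le_galRange_of_isAbelianGalois L) Qm hQm
  exact hQ0 (congrArg Subtype.val hQm0)

/-- **`E(L)[p] = 0` for an abelian number field `L/ℚ` in any universe** (`p` odd, `E[p]`
irreducible): a `ℚ`-isomorphic model `L₀` of `L` in `Type` (`exists_algEquiv_numberField_type`) is
again abelian (`IsAbelianGalois.of_algHom`), and `E(L₀)[p] = 0` transports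
(`torsionBy_eq_bot_of_algEquiv`). [cite: Serre1972, §5.2 (iv) and §5.4] -/
theorem torsionBy_eq_bot_of_isAbelianGalois (L : Type u) [Field L] [NumberField L]
    [IsAbelianGalois ℚ L] (hp2 : p ≠ 2) (hirr : W.HasIrreducibleModPGaloisRep p) :
    AddSubgroup.torsionBy (W.baseChange L).toAffine.Point (p : ℤ) = ⊥ := by
  obtain ⟨L₀, _, _, ⟨e⟩⟩ := exists_algEquiv_numberField_type L
  haveI : IsAbelianGalois ℚ L₀ := IsAbelianGalois.of_algHom (K := ℚ) (M := L) (e : L₀ →ₐ[ℚ] L)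
  exact torsionBy_eq_bot_of_algEquiv W e (torsionBy_eq_bot_of_isAbelianGalois_type W p L₀ hp2 hirr)

/-- **`E(L)[p^M] = 0` for an abelian number field `L/ℚ`** (`p` odd, `E[p]` irreducible): no
`p`-torsion ⇒ no `p^M`-torsion (`torsionBy_pow_eq_bot`).  In particular every torsion point of
`E(L)` has order prime to `p`. [cite: Serre1972, §5.2 (iv) and §5.4] -/
theorem torsionBy_pow_eq_bot_of_isAbelianGalois (L : Type u) [Field L] [NumberField L]
    [IsAbelianGalois ℚ L] (hp2 : p ≠ 2) (hirr : W.HasIrreducibleModPGaloisRep p) (M : ℕ) :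
    AddSubgroup.torsionBy (W.baseChange L).toAffine.Point ((p ^ M : ℕ) : ℤ) = ⊥ :=
  torsionBy_pow_eq_bot (torsionBy_eq_bot_of_isAbelianGalois W p L hp2 hirr) M

/-- **`E(ℚ(ζ_N))[p^M] = 0`** (`p` odd, `E[p]` irreducible) for any cyclotomic extension `L/ℚ`
(`IsCyclotomicExtension S ℚ L`; Mathlib: cyclotomic ⇒ abelian, `IsCyclotomicExtension.isAbelianGalois`).
`ℚ(ζ_N)` is the field of rationality of the cusps of `X₀(N)` (Stevens 1982, Thm 1.3.1 (a)) used in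
F-d v2 (ii). [cite: Serre1972, §5.2 (iv) and §5.4] -/
theorem torsionBy_pow_eq_bot_of_isCyclotomicExtension (S : Set ℕ) (L : Type u) [Field L]
    [NumberField L] [IsCyclotomicExtension S ℚ L] (hp2 : p ≠ 2)
    (hirr : W.HasIrreducibleModPGaloisRep p) (M : ℕ) :
    AddSubgroup.torsionBy (W.baseChange L).toAffine.Point ((p ^ M : ℕ) : ℤ) = ⊥ := by
  haveI : IsAbelianGalois ℚ L := IsCyclotomicExtension.isAbelianGalois S ℚ L
  exact torsionBy_pow_eq_bot_of_isAbelianGalois W p L hp2 hirr M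

/-- **Row reading on class X4**: on an X4 pair `(E, p)` (`p ≠ 2 ∧ add(p) ∧ irr(p)`),
`E(L)[p^M] = 0` for every abelian number field `L/ℚ`. [cite: Serre1972, §5.2 (iv) and §5.4] -/
theorem torsionBy_pow_eq_bot_of_isAbelianGalois_of_classX4 (hX4 : ClassX4 W p) (L : Type u)
    [Field L] [NumberField L] [IsAbelianGalois ℚ L] (M : ℕ) :
    AddSubgroup.torsionBy (W.baseChange L).toAffine.Point ((p ^ M : ℕ) : ℤ) = ⊥ :=
  torsionBy_pow_eq_bot_of_isAbelianGalois W p L hX4.1 hX4.2.2 M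

end Summit.BirchSwinnertonDyer.Rank1Residual.GaloisImage

end
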